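import Literature.NumberTheory.LFunctions.XiLadderRowFour
import Literature.NumberTheory.LFunctions.XiLadderRowSix
import Literature.NumberTheory.LFunctions.XiLadderRowFive
import Literature.NumberTheory.LFunctions.XiLadderRowSeven
import Literature.NumberTheory.LFunctions.XiLadderRowEight
import Literature.NumberTheory.LFunctions.JensenXiLowStretchEight
import Literature.NumberTheory.LFunctions.JensenXiLadderBoxEightCellFree
import HarnessLib

/-!
# Theorem A of the Jensen track: the corollaries that plug the analytic rows into the assemblies

`XiLadderRowFour.lean` (jensen-p1) PROVES the degree-`4` analytic row of the track,
`ladderMomentBounds_four_of_ge : ∀ n ≥ 10⁵, LadderMomentBounds 4 blLadderConst (3/20) (1/141) n`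
(Brascamp–Lieb variance bound + Gaussian domination + un-conditioning; zero-free, enclosure-free, axioms
standard), whence `jensenHyperbolicFrom_xi_four_hundredThousand : JensenHyperbolicFrom xiTaylorCoeff 4 100000`.
This file records what follows through the kernel box certificates, the degree descent and the
enclosure-conditional stretches of this directory (jensen-lead J-R20 (a)/(b)):

* KERNEL · UNCONDITIONAL · ZERO-FREE: `jensenHyperbolicFrom_le_four_hundredThousand : d ≤ 4 →
  JensenHyperbolicFrom xiTaylorCoeff d 100000` (degrees `1, 2, 3, 4`; e.g. the Turán inequalities for every
  shift `n ≥ 10⁵` — classically known for all `n`, Csordas–Norfolk–Varga 1986; here as a by-product);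
* ENCLOSURE class (certified numerics of the engines as hypotheses), zero-free:
  `jensenXiAllShifts_four_of_enclosures : xiBoxStage1e3.Encloses xiTaylorCoeff → XiMomentsInHullFourLow →
  XiMomentsInHullFour → JensenXiAllShifts 4` and the `d ≤ 4` form;
* the DEGREE-GENERIC enclosure assembly (jensen-lead J-R22 (b)): the degree-`8` enclosures (coefficient balls
  `n ≤ 1200`, hulls `[1201, 9999]`, `[10⁴, 3·10⁶]`) certify `J^{8,n}_ξ` — hence, by descent at fixed `n`, `J^{d₀,n}_ξ`
  for every `d₀ ≤ 8` — on `[0, 3·10⁶]`, so ANY degree-`d₀` tail from `N ≤ 3000001` closes every `d ≤ d₀`: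
  `jensenXiAllShifts_le_of_enclosures_of_tail`; plugged rows: `d₀ = 4` (`N = 10⁵`) and **`d₀ = 6` (`N = 2·10⁶`,
  `XiLadderRowSix.lean`): `jensenXiAllShifts_le_six_of_enclosures : XiCoeffBallsEight → XiMomentsInHullEightLow →
  XiMomentsInHullEight → ∀ d ≤ 6, JensenXiAllShifts d`**, and `jensenHyperbolicFrom_le_six_twoMillion` (KERNEL ·
  UNCONDITIONAL: every `d ≤ 6`, every `n ≥ 2·10⁶`);
* the degree-`8` all-shift, all-degree statement with the analytic row of record as its ONLY non-enclosure
  input: `jensenXiAllShifts_le_eight_of_enclosures_of_row : XiCoeffBallsEight → XiMomentsInHullEightLow →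
  XiMomentsInHullEight → (∀ n ≥ 3·10⁶, LadderMomentBounds 8 (kappaGaussLadderConst (11/10)) (17/200) (1/2449) n)
  → ∀ d ≤ 8, JensenXiAllShifts d` (ENCLOSURE class end to end once the degree-`8` row is a theorem).

THEOREM A of the track, sentence of record (jensen-lead J-R18/J-R19): ENCLOSURE class — `J^{d,n}_ξ` hyperbolic
for ALL shifts `n` and all `d ≤ 8`; KERNEL class — `d ≤ 4` for `n ≥ 10⁵` and `d ≤ 6` for `n ≥ 2·10⁶` (THIS FILE, unconditional),
`d ≤ 5` for `n ≥ 2·10⁵` and `d ≤ 8` for `n ≥ 3·10⁶` (when those rows land); everything is contained in the COMPILED-class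
tree theorem `jensenPoly_xiTaylorCoeff_splits_allShifts_of_le_1e8`. No input on the zeros of `ζ` here.

## References
* [GORZPNAS2019] Griffin–Ono–Rolen–Zagier, PNAS 116 (2019), Thms. 2, 3, 7, §5.1–5.2.
* [BrascampLieb1976] H. J. Brascamp, E. H. Lieb, J. Funct. Anal. 22 (1976) 366–389, Thms. 4.1, 5.1.
* [CsordasNorfolkVarga1986] Csordas–Norfolk–Varga, Trans. AMS 296 (1986) 521–541, Thm. 2.5.
-/

open Polynomial Finset

namespace Literature.NumberTheory.LFunctions

/-- **KERNEL · UNCONDITIONAL: for every `d ≤ 4` and every shift `n ≥ 10⁵`, `J^{d,n}_ξ` is hyperbolic**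
(the degree-`4` analytic row of jensen-p1 + degree descent; no zeros of `ζ`, no enclosure, no named fact).
[cite: GORZPNAS2019, Thm. 2 and §5.2] -/
theorem jensenHyperbolicFrom_le_four_hundredThousand {d : ℕ} (hd : d ≤ 4) :
    JensenHyperbolicFrom xiTaylorCoeff d 100000 :=
  jensenHyperbolicFrom_of_le hd jensenHyperbolicFrom_xi_four_hundredThousand

/-- **ENCLOSURE class, all shifts at `d = 4`** (jensen-lead J-R20 (a)): coefficient balls for `n < 104`, moment
hulls on `[104, 9999]` and `[10⁴, 10⁵]` (certified numerics, hypotheses) and the PROVED analytic row from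
`10⁵` give `J^{4,n}_ξ` hyperbolic for every `n`. [cite: GORZPNAS2019, Thm. 2 and §5.2] -/
theorem jensenXiAllShifts_four_of_enclosures (hγ : xiBoxStage1e3.Encloses xiTaylorCoeff)
    (hlow : XiMomentsInHullFourLow) (h1 : XiMomentsInHullFour) : JensenXiAllShifts 4 :=
  jensenXiAllShifts_four_of_enclosures_of_ladder hγ hlow h1 ladderMomentBounds_four_of_ge

/-- **ENCLOSURE class, all shifts, every `d ≤ 4`** (same hypotheses). [cite: GORZPNAS2019, Thm. 2 and §5.2] -/
theorem jensenXiAllShifts_le_four_of_enclosures (hγ : xiBoxStage1e3.Encloses xiTaylorCoeff)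
    (hlow : XiMomentsInHullFourLow) (h1 : XiMomentsInHullFour) {d : ℕ} (hd : d ≤ 4) :
    JensenXiAllShifts d :=
  jensenXiAllShifts_le_four_of_enclosures_of_ladder hγ hlow h1 ladderMomentBounds_four_of_ge hd

/-- **The degree-generic enclosure assembly** (jensen-lead J-R22 (b)): the degree-`8` enclosures certify
`J^{8,n}_ξ`, hence `J^{d₀,n}_ξ` for any `d₀ ≤ 8` (descent at fixed `n`), on every `n ≤ 3·10⁶`; so a hyperbolic
degree-`d₀` tail from any `N ≤ 3000001` gives `J^{d,n}_ξ` hyperbolic for every `n` and every `d ≤ d₀`.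
[cite: GORZPNAS2019, Thm. 2 and §5.2] -/
theorem jensenXiAllShifts_le_of_enclosures_of_tail {d₀ N : ℕ} (hd₀ : d₀ ≤ 8) (hN : N ≤ 3000001)
    (hγ : XiCoeffBallsEight) (hlow : XiMomentsInHullEightLow) (h1 : XiMomentsInHullEight)
    (h2 : JensenHyperbolicFrom xiTaylorCoeff d₀ N) {d : ℕ} (hd : d ≤ d₀) : JensenXiAllShifts d := by
  refine jensenXiAllShifts_of_le hd fun n => ?_
  by_cases hn : n < N
  · have h8 : (jensenPoly xiTaylorCoeff 8 n).Splits := by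
      by_cases hlow' : n < 10000
      · exact jensenHyperbolicBelow_eight_of_balls_of_hulls hγ hlow n hlow'
      · exact jensenPoly_eight_splits_on_stretch h1 (by omega) (by omega)
    exact splits_jensenPoly_of_le hd₀ h8
  · exact h2 n (by omega)

/-- **Row `d₀ = 4` plugged (N = 10⁵, `XiLadderRowFour.lean`):** every `d ≤ 4`, all shifts, under the three
degree-`8` enclosure hypotheses. [cite: GORZPNAS2019, Thm. 2 and §5.2] -/
theorem jensenXiAllShifts_le_four_of_eightEnclosures (hγ : XiCoeffBallsEight)
    (hlow : XiMomentsInHullEightLow) (h1 : XiMomentsInHullEight) {d : ℕ} (hd : d ≤ 4) :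
    JensenXiAllShifts d :=
  jensenXiAllShifts_le_of_enclosures_of_tail (by norm_num) (by norm_num) hγ hlow h1
    jensenHyperbolicFrom_xi_four_hundredThousand hd

/-- **KERNEL · UNCONDITIONAL: for every `d ≤ 6` and every shift `n ≥ 2·10⁶`, `J^{d,n}_ξ` is hyperbolic**
(the degree-`6` analytic row of jensen-p1, `XiLadderRowSix.lean`, + degree descent).
[cite: GORZPNAS2019, Thm. 2 and §5.2] -/
theorem jensenHyperbolicFrom_le_six_twoMillion {d : ℕ} (hd : d ≤ 6) :
    JensenHyperbolicFrom xiTaylorCoeff d 2000000 :=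
  jensenHyperbolicFrom_of_le hd jensenHyperbolicFrom_xi_six_twoMillion

/-- **Row `d₀ = 6` plugged (N = 2·10⁶, `XiLadderRowSix.lean`): every `d ≤ 6`, ALL SHIFTS** — ENCLOSURE class end
to end (coefficient balls `n ≤ 1200`, moment hulls `[1201, 9999]` and `[10⁴, 3·10⁶]` as certified-numerics
hypotheses), zero-free, no STEP-0 evidence. [cite: GORZPNAS2019, Thm. 2 and §5.2] -/
theorem jensenXiAllShifts_le_six_of_enclosures (hγ : XiCoeffBallsEight) (hlow : XiMomentsInHullEightLow)
    (h1 : XiMomentsInHullEight) {d : ℕ} (hd : d ≤ 6) : JensenXiAllShifts d :=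
  jensenXiAllShifts_le_of_enclosures_of_tail (by norm_num) (by norm_num) hγ hlow h1
    jensenHyperbolicFrom_xi_six_twoMillion hd

/-- **ENCLOSURE class end to end, every `d ≤ 8`, given the degree-`8` row of record** (jensen-lead J-R20 (b)):
coefficient balls (`n ≤ 1200`), moment hulls (`[1201, 9999]`, `[10⁴, 3·10⁶]`) and the analytic row
`LadderMomentBounds 8 (kappaGaussLadderConst (11/10)) (17/200) (1/2449)` from `3·10⁶` give `J^{d,n}_ξ`
hyperbolic for every `n` and every `d ≤ 8`. [cite: GORZPNAS2019, Thm. 2 and §5.2] -/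
theorem jensenXiAllShifts_le_eight_of_enclosures_of_row (hγ : XiCoeffBallsEight)
    (hlow : XiMomentsInHullEightLow) (h1 : XiMomentsInHullEight)
    (h2 : ∀ n : ℕ, 3000000 ≤ n →
      LadderMomentBounds 8 (kappaGaussLadderConst (11 / 10)) (17 / 200) (1 / 2449) n)
    {d : ℕ} (hd : d ≤ 8) : JensenXiAllShifts d :=
  jensenXiAllShifts_le_eight_of_enclosures_of_tail (N := 3000000) (by norm_num) hγ hlow h1
    (jensenHyperbolicFrom_eight_of_ladderMomentBoundsKappa h2) hd

/-! ## Row `d₀ = 5` (appended on the acceptance of `XiLadderRowFive.lean`, p329400) -/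

/-- **KERNEL · UNCONDITIONAL: for every `d ≤ 5` and every shift `n ≥ 2·10⁵`, `J^{d,n}_ξ` is hyperbolic**
(the degree-`5` analytic row of jensen-p1, `XiLadderRowFive.lean`: `∀ n ≥ 2·10⁵, LadderMomentBounds 5
blLadderConst (3/25) (1/190) n` through the crude box of `JensenXiLadderBoxFive.lean`, + degree descent).
[cite: GORZPNAS2019, Thm. 2 and §5.2] -/
theorem jensenHyperbolicFrom_le_five_twoHundredThousand {d : ℕ} (hd : d ≤ 5) :
    JensenHyperbolicFrom xiTaylorCoeff d 200000 :=
  jensenHyperbolicFrom_of_le hd jensenHyperbolicFrom_xi_five_twoHundredThousand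

/-- **Row `d₀ = 5` plugged (N = 2·10⁵): every `d ≤ 5`, all shifts** under the three degree-`8` enclosure
hypotheses (subsumed by `jensenXiAllShifts_le_six_of_enclosures`; recorded for the threshold ladder
`10⁵ (d ≤ 4) · 2·10⁵ (d ≤ 5) · 2·10⁶ (d ≤ 6)`). [cite: GORZPNAS2019, Thm. 2 and §5.2] -/
theorem jensenXiAllShifts_le_five_of_enclosures (hγ : XiCoeffBallsEight) (hlow : XiMomentsInHullEightLow)
    (h1 : XiMomentsInHullEight) {d : ℕ} (hd : d ≤ 5) : JensenXiAllShifts d :=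
  jensenXiAllShifts_le_of_enclosures_of_tail (by norm_num) (by norm_num) hγ hlow h1
    jensenHyperbolicFrom_xi_five_twoHundredThousand hd

/-! ## Row `d₀ = 7` (appended on the acceptance of `XiLadderRowSeven.lean`, p330139) -/

/-- **KERNEL · UNCONDITIONAL: for every `d ≤ 7` and every shift `n ≥ 3·10⁶`, `J^{d,n}_ξ` is hyperbolic**
(the degree-`7` analytic row of jensen-p1, `XiLadderRowSeven.lean`: `∀ n ≥ 3·10⁶, LadderMomentBounds 7
blLadderConst (17/200) (1/1414) n` through the crude box of `JensenXiLadderBoxSeven.lean`, + degree descent;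
no zeros of `ζ`, no enclosure, no named fact). [cite: GORZPNAS2019, Thm. 2 and §5.2] -/
theorem jensenHyperbolicFrom_le_seven_threeMillion {d : ℕ} (hd : d ≤ 7) :
    JensenHyperbolicFrom xiTaylorCoeff d 3000000 :=
  jensenHyperbolicFrom_of_le hd jensenHyperbolicFrom_xi_seven_threeMillion

/-- **Row `d₀ = 7` plugged (N = 3·10⁶): for every `d ≤ 7` and EVERY shift `n`, `J^{d,n}_ξ` is hyperbolic** —
KERNEL proof under the THREE certified-numerics ENCLOSURE hypotheses (coefficient balls `n ≤ 1200` [E2 lineage],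
moment hulls `1201 ≤ n ≤ 9999` and `10⁴ ≤ n ≤ 3·10⁶` [E1-M balls]) plus the analytic row `d = 7` from
`N = 3·10⁶ ≤ 3·10⁶ + 1` (tree theorem); no zero of `ζ`, no RH(T), no STEP-0 evidence (class sentence of record,
jensen-lead J-R22 (a), with `D₀ = 7`). [cite: GORZPNAS2019, Thm. 2 and §5.2] -/
theorem jensenXiAllShifts_le_seven_of_enclosures (hγ : XiCoeffBallsEight) (hlow : XiMomentsInHullEightLow)
    (h1 : XiMomentsInHullEight) {d : ℕ} (hd : d ≤ 7) : JensenXiAllShifts d :=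
  jensenXiAllShifts_le_of_enclosures_of_tail (by norm_num) (by norm_num) hγ hlow h1
    jensenHyperbolicFrom_xi_seven_threeMillion hd

/-! ## Row `d₀ = 8` (appended on the acceptance of `XiLadderRowEight.lean`, p331340) -/

/-- **KERNEL · UNCONDITIONAL: for every `d ≤ 8` and every shift `n ≥ 3·10⁶`, `J^{d,n}_ξ` is hyperbolic**
(the degree-`8` analytic row of jensen-p1, `XiLadderRowEight.lean`: `ladderMomentBounds_eight_of_ge :
∀ n ≥ 3·10⁶, LadderMomentBounds 8 (kappaGaussLadderConst (11/10)) (17/200) (1/2449) n` — the literal analytic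
row hypothesis of `jensenXiAllShifts_le_eight_of_enclosures_of_row` — through the kernel-certified cell-free box
`ladderBoxEightKappa_certifies` of `JensenXiLadderBoxEightCellFree.lean`, + degree descent; no zeros of `ζ`, no
enclosure, no named fact). [cite: GORZPNAS2019, Thm. 2 and §5.2] -/
theorem jensenHyperbolicFrom_le_eight_threeMillion {d : ℕ} (hd : d ≤ 8) :
    JensenHyperbolicFrom xiTaylorCoeff d 3000000 :=
  jensenHyperbolicFrom_of_le hd jensenHyperbolicFrom_xi_eight_threeMillion

/-- **Row `d₀ = 8` plugged (N = 3·10⁶) — THEOREM A of the track, sentence of record, ENCLOSURE class END TO END: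
for every `d ≤ 8` and EVERY shift `n`, `J^{d,n}_ξ` is hyperbolic** — KERNEL proof under the THREE
certified-numerics ENCLOSURE hypotheses (coefficient balls `n ≤ 1200` [E2 lineage], moment hulls `1201 ≤ n ≤ 9999`
and `10⁴ ≤ n ≤ 3·10⁶` [E1-M balls]) plus the analytic row `d = 8` from `N = 3·10⁶ ≤ 3·10⁶ + 1` (tree theorem);
no zero of `ζ`, no RH(T), no STEP-0 evidence (class sentence of record, jensen-lead J-R22 (a), with `D₀ = 8`).
[cite: GORZPNAS2019, Thm. 2 and §5.2] -/
theorem jensenXiAllShifts_le_eight_of_enclosures (hγ : XiCoeffBallsEight) (hlow : XiMomentsInHullEightLow)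
    (h1 : XiMomentsInHullEight) {d : ℕ} (hd : d ≤ 8) : JensenXiAllShifts d :=
  jensenXiAllShifts_le_of_enclosures_of_tail (by norm_num) (by norm_num) hγ hlow h1
    jensenHyperbolicFrom_xi_eight_threeMillion hd

/-- **`d = 8` itself, all shifts** (the GORZ Theorem 2 range `d ≤ 8`, top degree), same three enclosure
hypotheses. [cite: GORZPNAS2019, Thm. 2 and §5.2] -/
theorem jensenXiAllShifts_eight_of_enclosures (hγ : XiCoeffBallsEight) (hlow : XiMomentsInHullEightLow)
    (h1 : XiMomentsInHullEight) : JensenXiAllShifts 8 :=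
  jensenXiAllShifts_le_eight_of_enclosures hγ hlow h1 le_rfl

end Literature.NumberTheory.LFunctions
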